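import Mathlib.Geometry.Manifold.IsManifold.Basic
import HarnessLib

/-!
# Two closure facts for maximal atlases: post-composition with a groupoid element; linear
# automorphisms of the model vector space are `C^n` structomorphisms

Small general complements to Mathlib's atlas API (`Mathlib/Geometry/Manifold/HasGroupoid.lean`,
`IsManifold/Basic.lean`), needed whenever a chart of the maximal atlas is RE-COORDINATISED by a
diffeomorphism of the model space — e.g. tilting a chart by a linear change of coordinates so that a
prescribed tangent vector becomes the first coordinate direction (used for the crux
`NonTrappingHawkingRigidity` of the summit `FinalStateConjecture`, line `Sketch`, stub
`stub_twoVariableAnalyticitySeeds`):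

* `StructureGroupoid.trans_mem_maximalAtlas_of_mem` — if `e ∈ G.maximalAtlas M` and `f ∈ G` (a
  groupoid element of the model space `H`), then `e.trans f ∈ G.maximalAtlas M` (Mathlib has the
  special cases `G.mem_maximalAtlas_of_mem_groupoid` for `M = H` and `restr_mem_maximalAtlas`);
* `ContinuousLinearEquiv.toOpenPartialHomeomorph_mem_contDiffGroupoid` — a continuous linear
  automorphism `A : E ≃L[𝕜] E` of the model vector space, viewed as an `OpenPartialHomeomorph`, lies in
  `contDiffGroupoid n 𝓘(𝕜, E)` for every `n`.

Everything is proved; no definitions, no named facts.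

## References

* Mathlib, `Mathlib/Geometry/Manifold/HasGroupoid.lean` (`mem_maximalAtlas_iff`,
  `StructureGroupoid.mem_maximalAtlas_of_mem_groupoid`); J. M. Lee, *Introduction to Smooth
  Manifolds*, 2nd ed., Prop. 1.17 (smooth structures and maximal atlases). [folklore]
-/

open Set
open scoped Manifold ContDiff Topology

namespace Literature.Geometry.Manifold

section Groupoid

variable {H : Type*} [TopologicalSpace H] {M : Type*} [TopologicalSpace M] [ChartedSpace H M]
  (G : StructureGroupoid H)

/-- **Post-composing a chart of the maximal atlas with an element of the structure groupoid stays in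
the maximal atlas**: if `e ∈ G.maximalAtlas M` and `f : H → H` is in `G`, then `e.trans f ∈
G.maximalAtlas M` (compatibility with every chart `e'` of the atlas: `(e.trans f)⁻¹ ∘ e' =
f⁻¹ ∘ (e⁻¹ ∘ e')` and `e'⁻¹ ∘ (e.trans f) = (e'⁻¹ ∘ e) ∘ f` are compositions of groupoid elements).
Lee 2012, Prop. 1.17 (c). [folklore] -/
theorem _root_.StructureGroupoid.trans_mem_maximalAtlas_of_mem {e : OpenPartialHomeomorph M H}
    (he : e ∈ G.maximalAtlas M) {f : OpenPartialHomeomorph H H} (hf : f ∈ G) :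
    e.trans f ∈ G.maximalAtlas M := by
  rw [mem_maximalAtlas_iff] at he ⊢
  intro e' he'
  obtain ⟨h₁, h₂⟩ := he e' he'
  constructor
  · rw [OpenPartialHomeomorph.trans_symm_eq_symm_trans_symm, OpenPartialHomeomorph.trans_assoc]
    exact G.trans (G.symm hf) h₁
  · rw [← OpenPartialHomeomorph.trans_assoc]
    exact G.trans h₂ hf

end Groupoid

section Linear

variable {𝕜 : Type*} [NontriviallyNormedField 𝕜] {E : Type*} [NormedAddCommGroup E] [NormedSpace 𝕜 E]

/-- **A continuous linear automorphism of the model vector space is a `C^n` structomorphism**: viewed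
as an `OpenPartialHomeomorph E E` (source and target `univ`), `A : E ≃L[𝕜] E` belongs to
`contDiffGroupoid n 𝓘(𝕜, E)` for every `n` (both `A` and `A⁻¹` are `C^∞`). [folklore] -/
theorem _root_.ContinuousLinearEquiv.toOpenPartialHomeomorph_mem_contDiffGroupoid (A : E ≃L[𝕜] E)
    (n : WithTop ℕ∞) : A.toHomeomorph.toOpenPartialHomeomorph ∈ contDiffGroupoid n 𝓘(𝕜, E) := by
  rw [contDiffGroupoid, mem_groupoid_of_pregroupoid]
  refine ⟨?_, ?_⟩
  · simp only [contDiffPregroupoid, Homeomorph.toOpenPartialHomeomorph_source, preimage_univ,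
      univ_inter, modelWithCornersSelf_coe, modelWithCornersSelf_coe_symm, Function.comp_id,
      Function.id_comp, range_id]
    exact A.contDiff.contDiffOn
  · simp only [contDiffPregroupoid, Homeomorph.toOpenPartialHomeomorph_target, preimage_univ,
      univ_inter, modelWithCornersSelf_coe, modelWithCornersSelf_coe_symm, Function.comp_id,
      Function.id_comp, range_id]
    exact A.symm.contDiff.contDiffOn

/-- **Re-coordinatising a smooth chart by a linear automorphism**: for a chart `e` of the maximal
`C^n` atlas of a manifold modelled on the vector space `E` (model with corners `𝓘(𝕜, E)`) and a
continuous linear automorphism `A` of `E`, the chart `A ∘ e` is again in the maximal atlas. [folklore] -/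
theorem trans_continuousLinearEquiv_mem_maximalAtlas {M : Type*} [TopologicalSpace M]
    [ChartedSpace E M] {n : WithTop ℕ∞} {e : OpenPartialHomeomorph M E}
    (he : e ∈ IsManifold.maximalAtlas 𝓘(𝕜, E) n M) (A : E ≃L[𝕜] E) :
    e.trans A.toHomeomorph.toOpenPartialHomeomorph ∈ IsManifold.maximalAtlas 𝓘(𝕜, E) n M :=
  (contDiffGroupoid n 𝓘(𝕜, E)).trans_mem_maximalAtlas_of_mem he
    (A.toOpenPartialHomeomorph_mem_contDiffGroupoid n)

end Linear

end Literature.Geometry.Manifold
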